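import Literature.MathematicalPhysics.QuantumLattice.DysonOrderedIntegral
import Mathlib.Analysis.Normed.Ring.InfiniteSum
import HarnessLib

/-!
# The two-time Dyson expansion: `Tr(e^{t₁(A+gB)} X e^{t₂(A+gB)} Y)` as an entire series in the coupling

Topic `MathematicalPhysics/QuantumLattice`; continuation of `DysonExpansion.lean` (`Matrix.hasSum_dysonTerm`:
`e^{t(A+gB)} = Σ_k g^k E_k(t)`, absolutely convergent) and `DysonOrderedIntegral.lean` (the Dyson terms as ordered simplex
integrals).  The imaginary-time TWO-POINT (two-time) correlation functions of a perturbed Gibbs state,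
`Tr(e^{-(β-s)H} X e^{-sH} Y)` with `H = H₀ + gV` and `0 ≤ s ≤ β` (Bratteli–Robinson II, §5.3.1: the KMS two-point functions
`F_{X,Y}`; Benfatto–Giuliani–Mastropietro 2006, §1.2 (1.2)–(1.3): the Schwinger functions at unequal imaginary times), carry
TWO perturbed exponentials; multiplying their Dyson series (a Cauchy product of two absolutely convergent series in a complete
normed ring) gives an entire series in `g` whose `N`-th coefficient collects the pairs `(k, j)` with `k + j = N`:

* **`Matrix.hasSum_dysonTerm_twoTime`** — `e^{t₁(A+gB)} X e^{t₂(A+gB)} Y = Σ_N g^N Σ_{k+j=N} E_k(t₁) X E_j(t₂) Y` (`t₁, t₂ ≥ 0`);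
* `Matrix.hasSum_dyson_trace_twoTime` — the same inside the trace;
* **`Matrix.hasSum_dyson_trace_gibbs_twoTime`** — for `0 < β`, `0 ≤ s ≤ β` and every observable pair `X, Y`:
  `Tr(e^{-(β-s)(H₀+gV)} X e^{-s(H₀+gV)} Y) = Σ_N g^N Σ_{k+j=N} Tr(E_k(1 - s/β) X E_j(s/β) Y)` with `E = E[-βH₀, -βV]` — the
  two-time analogue of `Matrix.hasSum_dyson_trace_gibbsWeight_mul` (which is the case `s = 0`, `X = 1`);
* `trace_dysonTerm_mul_dysonTerm_mul_eq_orderedIntegral` — each coefficient as a DOUBLE ordered integral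
  `∫_{Δ_k(t₁)} ∫_{Δ_j(t₂)} Tr((∏_i e^{u_iA}Be^{-u_iA}) e^{t₁A} X (∏_l e^{u'_lA}Be^{-u'_lA}) e^{t₂A} Y)`.

Everything is PROVED; no definition is introduced.  The free expectations inside the coefficients are evaluated by the
time-ordered Wick theorem elsewhere (`FermionQuasiFreeTimeOrderedWick`), exactly as for the one-time series.

## Mathlib / tree search

Mathlib: `tsum_mul_tsum_eq_tsum_sum_antidiagonal_of_summable_norm`, `summable_norm_sum_mul_antidiagonal_of_summable_norm`
(Cauchy product in a complete normed ring), the scoped `Matrix.Norms.L2Operator` normed-ring structure.  Tree: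
`Matrix.hasSum_dysonTerm`, `Matrix.summable_norm_dysonTerm`, `Matrix.norm_dysonTerm_le` (`DysonExpansion`),
`dysonTerm_eq_orderedIntegral`, `ContinuousLinearMap.orderedIntegral_comp_comm`, `continuous_dysonIntegrand`
(`DysonOrderedIntegral`); no two-time version (`lean search 'twoTime|two_time'` in the Dyson files: none).

## References

* O. Bratteli, D. W. Robinson, *Operator Algebras and Quantum Statistical Mechanics II*, 2nd ed. (Springer 1997), §5.3.1
  (two-point KMS functions), §5.4.1 (perturbation expansions of KMS states). [BratteliRobinsonII1997]
* O. Bratteli, D. W. Robinson, *Operator Algebras and Quantum Statistical Mechanics I*, 2nd ed. (1987), Thm. 3.1.33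
  (the Dyson series). [BratteliRobinsonI1987]
* G. Benfatto, A. Giuliani, V. Mastropietro, Ann. Henri Poincaré 7 (2006) 809–898, §1.2 (1.2)–(1.3), §2.1 (2.8).
  [BenfattoGiulianiMastropietro2006]
-/

noncomputable section

open scoped Matrix.Norms.L2Operator
open Finset Finset.Nat MeasureTheory Filter Topology NormedSpace Literature.MathematicalPhysics.QuantumLattice

namespace Matrix

variable {m : Type*} [Fintype m] [DecidableEq m]

/-! ### The Cauchy product of two Dyson series -/

/-- `Σ_k ‖g^k E_k(t) X‖ < ∞` for `t ≥ 0` (the Dyson series times a fixed matrix is absolutely convergent). [folklore] -/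
private theorem summable_norm_dysonTerm_mul (A B X : Matrix m m ℂ) (g : ℂ) {t : ℝ} (ht : 0 ≤ t) :
    Summable fun k => ‖g ^ k • dysonTerm A B k t * X‖ := by
  refine Summable.of_nonneg_of_le (fun k => norm_nonneg _) (fun k => ?_) ((summable_norm_dysonTerm A B g ht).mul_right ‖X‖)
  exact norm_mul_le _ _

/-- **The two-time Dyson expansion.**  For `t₁, t₂ ≥ 0` and every complex coupling `g`,
`e^{t₁(A+gB)} X e^{t₂(A+gB)} Y = Σ_N g^N Σ_{k+j=N} E_k(t₁) X E_j(t₂) Y` (Cauchy product of the two absolutely convergent Dyson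
series `Matrix.hasSum_dysonTerm`). [cite: BratteliRobinsonII1997, §5.4.1] -/
theorem hasSum_dysonTerm_twoTime (A B X Y : Matrix m m ℂ) (g : ℂ) {t₁ t₂ : ℝ} (ht₁ : 0 ≤ t₁) (ht₂ : 0 ≤ t₂) :
    HasSum (fun N : ℕ => g ^ N • ∑ kj ∈ antidiagonal N, dysonTerm A B kj.1 t₁ * X * (dysonTerm A B kj.2 t₂ * Y))
      (exp (t₁ • (A + g • B)) * X * (exp (t₂ • (A + g • B)) * Y)) := by
  have hf := summable_norm_dysonTerm_mul A B X g ht₁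
  have hg := summable_norm_dysonTerm_mul A B Y g ht₂
  -- the Cauchy product is summable and sums to the product of the sums
  have hsum := summable_norm_sum_mul_antidiagonal_of_summable_norm hf hg
  have hprod := tsum_mul_tsum_eq_tsum_sum_antidiagonal_of_summable_norm hf hg
  have h1 : ∑' k, g ^ k • dysonTerm A B k t₁ * X = exp (t₁ • (A + g • B)) * X := by
    rw [(summable_norm_dysonTerm A B g ht₁).of_norm.tsum_mul_right X, (hasSum_dysonTerm A B g ht₁).tsum_eq]
  have h2 : ∑' k, g ^ k • dysonTerm A B k t₂ * Y = exp (t₂ • (A + g • B)) * Y := by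
    rw [(summable_norm_dysonTerm A B g ht₂).of_norm.tsum_mul_right Y, (hasSum_dysonTerm A B g ht₂).tsum_eq]
  rw [h1, h2] at hprod
  -- identify the `N`-th Cauchy term
  have hterm : ∀ N : ℕ, ∑ kl ∈ antidiagonal N, g ^ kl.1 • dysonTerm A B kl.1 t₁ * X * (g ^ kl.2 • dysonTerm A B kl.2 t₂ * Y) =
      g ^ N • ∑ kj ∈ antidiagonal N, dysonTerm A B kj.1 t₁ * X * (dysonTerm A B kj.2 t₂ * Y) := by
    intro N
    rw [Finset.smul_sum]
    refine Finset.sum_congr rfl fun kl hkl => ?_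
    rw [HasAntidiagonal.mem_antidiagonal] at hkl
    rw [← hkl, pow_add, mul_smul]
    simp only [smul_mul_assoc, mul_smul_comm]
    exact smul_comm _ _ _
  have hs : Summable fun N : ℕ => g ^ N • ∑ kj ∈ antidiagonal N, dysonTerm A B kj.1 t₁ * X * (dysonTerm A B kj.2 t₂ * Y) := by
    refine (hsum.of_norm).congr fun N => hterm N
  rw [show exp (t₁ • (A + g • B)) * X * (exp (t₂ • (A + g • B)) * Y) =
      ∑' N : ℕ, g ^ N • ∑ kj ∈ antidiagonal N, dysonTerm A B kj.1 t₁ * X * (dysonTerm A B kj.2 t₂ * Y) by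
    rw [hprod]; exact tsum_congr hterm]
  exact hs.hasSum

/-- **The two-time Dyson expansion inside the trace**: `Tr(e^{t₁(A+gB)} X e^{t₂(A+gB)} Y) = Σ_N g^N Σ_{k+j=N} Tr(E_k(t₁) X E_j(t₂) Y)`
(`t₁, t₂ ≥ 0`). [cite: BratteliRobinsonII1997, §5.4.1] -/
theorem hasSum_dyson_trace_twoTime (A B X Y : Matrix m m ℂ) (g : ℂ) {t₁ t₂ : ℝ} (ht₁ : 0 ≤ t₁) (ht₂ : 0 ≤ t₂) :
    HasSum (fun N : ℕ => g ^ N * ∑ kj ∈ antidiagonal N, (dysonTerm A B kj.1 t₁ * X * (dysonTerm A B kj.2 t₂ * Y)).trace)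
      (exp (t₁ • (A + g • B)) * X * (exp (t₂ • (A + g • B)) * Y)).trace := by
  set L : Matrix m m ℂ →L[ℂ] ℂ := LinearMap.toContinuousLinearMap (Matrix.traceLinearMap m ℂ ℂ) with hL
  have hLapply : ∀ Z : Matrix m m ℂ, L Z = Z.trace := fun Z => rfl
  have h := (hasSum_dysonTerm_twoTime A B X Y g ht₁ ht₂).mapL L
  simp only [hLapply, trace_smul, smul_eq_mul, trace_sum] at h
  exact h

omit [Fintype m] [DecidableEq m] in
/-- Rescaling the Gibbs exponent: `((β - s)/β) • (-β(H₀ + gV)) = -(β - s) • (H₀ + gV)` and `(s/β) • (-β(H₀+gV)) = -s • (H₀+gV)`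
(`β ≠ 0`). [folklore] -/
private theorem div_smul_neg_smul_eq {β : ℝ} (hβ : β ≠ 0) (r : ℝ) (H : Matrix m m ℂ) :
    (r / β) • (-(β : ℂ) • H) = -((r : ℂ) • H) := by
  have hβ' : (β : ℂ) ≠ 0 := by exact_mod_cast hβ
  rw [← Complex.coe_smul, smul_smul, ← neg_smul]
  congr 1
  push_cast
  field_simp

/-- **The two-time Dyson expansion of a perturbed Gibbs weight.**  For `β > 0`, `0 ≤ s ≤ β`, `H = H₀ + gV` and every pair of
observables `X, Y`:
`Tr(e^{-(β-s)H} X e^{-sH} Y) = Σ_N g^N Σ_{k+j=N} Tr(E_k(1 - s/β) X E_j(s/β) Y)`, `E_k = E_k[-βH₀, -βV]` — an entire series in the coupling,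
in every finite dimension; the case `s = 0`, `X = 1` is `Matrix.hasSum_dyson_trace_gibbsWeight_mul`. [cite: BratteliRobinsonII1997, §5.4.1] -/
theorem hasSum_dyson_trace_gibbs_twoTime {β : ℝ} (hβ : 0 < β) (H₀ V X Y : Matrix m m ℂ) (g : ℂ) {s : ℝ} (hs0 : 0 ≤ s)
    (hsβ : s ≤ β) :
    HasSum (fun N : ℕ => g ^ N * ∑ kj ∈ antidiagonal N,
        (dysonTerm (-(β : ℂ) • H₀) (-(β : ℂ) • V) kj.1 ((β - s) / β) * X *
          (dysonTerm (-(β : ℂ) • H₀) (-(β : ℂ) • V) kj.2 (s / β) * Y)).trace)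
      (exp (-((((β - s : ℝ) : ℂ)) • (H₀ + g • V))) * X * (exp (-((s : ℂ) • (H₀ + g • V))) * Y)).trace := by
  have ht₁ : 0 ≤ (β - s) / β := div_nonneg (sub_nonneg.2 hsβ) hβ.le
  have ht₂ : 0 ≤ s / β := div_nonneg hs0 hβ.le
  have h := hasSum_dyson_trace_twoTime (-(β : ℂ) • H₀) (-(β : ℂ) • V) X Y g ht₁ ht₂
  have hAB : -(β : ℂ) • H₀ + g • (-(β : ℂ) • V) = -(β : ℂ) • (H₀ + g • V) := by
    rw [smul_comm g, ← smul_add]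
  rw [hAB, div_smul_neg_smul_eq hβ.ne', div_smul_neg_smul_eq hβ.ne'] at h
  exact h

/-! ### The coefficients as double ordered integrals -/

/-- **Each two-time coefficient is a double ordered integral**:
`Tr(E_k(t₁) X E_j(t₂) Y) = ∫_{0≤u₀≤⋯≤u_{k-1}≤t₁} ∫_{0≤u'₀≤⋯≤u'_{j-1}≤t₂} Tr((∏_i e^{u_iA}Be^{-u_iA}) e^{t₁A} X (∏_l e^{u'_lA}Be^{-u'_lA}) e^{t₂A} Y)`.
[cite: BratteliRobinsonI1987, Thm. 3.1.33] -/
theorem trace_dysonTerm_mul_dysonTerm_mul_eq_orderedIntegral (A B X Y : Matrix m m ℂ) (k j : ℕ) (t₁ t₂ : ℝ) :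
    (dysonTerm A B k t₁ * X * (dysonTerm A B j t₂ * Y)).trace =
      orderedIntegral k (fun u : Fin k → ℝ =>
        orderedIntegral j (fun u' : Fin j → ℝ =>
          ((List.ofFn fun i : Fin k => exp (u i • A) * B * exp (-(u i • A))).prod * exp (t₁ • A) * X *
            (((List.ofFn fun l : Fin j => exp (u' l • A) * B * exp (-(u' l • A))).prod * exp (t₂ • A)) * Y)).trace) t₂) t₁ := by
  -- first the inner Dyson term, for a FIXED left factor `Z`
  have hinner : ∀ Z : Matrix m m ℂ, (Z * (dysonTerm A B j t₂ * Y)).trace =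
      orderedIntegral j (fun u' : Fin j → ℝ =>
        (Z * (((List.ofFn fun l : Fin j => exp (u' l • A) * B * exp (-(u' l • A))).prod * exp (t₂ • A)) * Y)).trace) t₂ := by
    intro Z
    set L : Matrix m m ℂ →L[ℝ] ℂ :=
      LinearMap.toContinuousLinearMap
        (((Matrix.traceLinearMap m ℂ ℂ) ∘ₗ ((LinearMap.mulLeft ℂ Z) ∘ₗ (LinearMap.mulRight ℂ Y))).restrictScalars ℝ) with hL
    have hLapply : ∀ W : Matrix m m ℂ, L W = (Z * (W * Y)).trace := fun W => rfl
    rw [dysonTerm_eq_orderedIntegral A B j t₂, ← hLapply, L.orderedIntegral_comp_comm j _ (continuous_dysonIntegrand A B _ j) t₂]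
    exact congrArg (fun F => orderedIntegral j F t₂) (funext fun u' => hLapply _)
  -- then the outer one
  set L' : Matrix m m ℂ →L[ℝ] ℂ :=
    LinearMap.toContinuousLinearMap
      (((Matrix.traceLinearMap m ℂ ℂ) ∘ₗ (LinearMap.mulRight ℂ (X * (dysonTerm A B j t₂ * Y)))).restrictScalars ℝ) with hL'
  have hL'apply : ∀ W : Matrix m m ℂ, L' W = (W * (X * (dysonTerm A B j t₂ * Y))).trace := fun W => rfl
  rw [Matrix.mul_assoc, dysonTerm_eq_orderedIntegral A B k t₁, ← hL'apply,
    L'.orderedIntegral_comp_comm k _ (continuous_dysonIntegrand A B _ k) t₁]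
  congr 1
  funext u
  rw [hL'apply, ← Matrix.mul_assoc, hinner]

end Matrix

end
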